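import Mathlib
import HarnessLib
import Summits.RiemannHypothesis.RiemannHypothesis.Theses.NbSectionTwoDyadic

/-!
# RiemannHypothesis / NbSectionTwoDyadic — the PRIMAL RESIDUAL of the dyadic extremal vector

Route `NbSectionTwoDyadic` (exact dyadic law of the 2-section of the truncated Nyman–Beurling
distance), crux `DyadicPrimalResidual` (item stmt-RiemannHypothesis-22782).

With `D = 18·2^K − 8` and the dyadic vector `a_i = (−1)^i · 6 (3·2^K − 2^(i+1)) / D` attached to the
generator `j = 2^i` (`i ≤ K`), the step-picture residual `1 − Σ_i a_i · min(2, ⌊k/2^i⌋)` is the constant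
`4(−2)^l / D` on each dyadic block `2^l ≤ k < 2^(l+1)` (`l ≤ K`), and the tail `1 − 2 Σ_i a_i` equals
`(−1)^(K+1) 2^(K+1) / D`.

Proof: `min(2, ⌊k/2^i⌋)` is `2, 1, 0` according as `i <, =, > l := ⌊log₂ k⌋`, so the sum is
`2 Σ_{i<l} a_i + a_l`; the closed form `1 − (2 Σ_{i<l} a_i + a_l) = 4(−2)^l/D` holds for EVERY `l` by
induction (`a_l + a_(l+1) = 12(−2)^l/D`), and the tail is the case `l = K + 1` rearranged.

Elementary finite sums; RH-free. No summit is proved by this file; nothing here bears on the truth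
of RH.
-/

noncomputable section

-- D-0017: `Summit.<S>.<S>.…` is the designed namespace of a single-problem summit.
set_option linter.dupNamespace false

namespace Summit.RiemannHypothesis.RiemannHypothesis.Theorems.NbSectionTwo

open Finset

/-- The normalising constant `D = 18·2^K − 8` is positive. -/
theorem dyadicD_pos (K : ℕ) : (0 : ℝ) < 18 * 2 ^ K - 8 := by
  have : (1 : ℝ) ≤ 2 ^ K := one_le_pow₀ (by norm_num)
  linarith

/-- `(−2)^n = (−1)^n · 2^n` in `ℝ`. -/
theorem neg_two_pow_eq (n : ℕ) : (-2 : ℝ) ^ n = (-1) ^ n * 2 ^ n := by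
  rw [← mul_pow]; norm_num

/-- Closed form of the damped alternating sums: for every `l` (no bound needed),
`1 − (2 Σ_{i<l} a_i + a_l) = 4(−2)^l / D` with `a_i = (−1)^i 6(3·2^K − 2^(i+1))/D`, `D = 18·2^K − 8`. -/
theorem primal_closed_form (K l : ℕ) :
    1 - (2 * (∑ i ∈ Finset.range l, (-1 : ℝ) ^ i * (6 * (3 * 2 ^ K - 2 ^ (i + 1))) / (18 * 2 ^ K - 8))
      + (-1 : ℝ) ^ l * (6 * (3 * 2 ^ K - 2 ^ (l + 1))) / (18 * 2 ^ K - 8))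
      = 4 * (-2 : ℝ) ^ l / (18 * 2 ^ K - 8) := by
  have hD : (18 * 2 ^ K - 8 : ℝ) ≠ 0 := (dyadicD_pos K).ne'
  induction l with
  | zero =>
    simp only [Finset.sum_range_zero, mul_zero, zero_add, pow_zero, one_mul, pow_one]
    rw [eq_div_iff hD, sub_mul, div_mul_cancel₀ _ hD]
    ring
  | succ l ih =>
    rw [Finset.sum_range_succ]
    simp only [neg_two_pow_eq] at ih ⊢
    linear_combination ih

/-- On the dyadic block `2^l ≤ k < 2^(l+1)` (`l = ⌊log₂ k⌋ ≤ K`) the pairing of a vector supported on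
the dyadic generators with the step pattern `min(2, ⌊k/2^i⌋)` is `2 Σ_{i<l} a_i + a_l`. -/
theorem sum_mul_min_two_div_pow (K k : ℕ) (hk : 1 ≤ k) (hk' : k < 2 ^ (K + 1)) (a : ℕ → ℝ) :
    ∑ i ∈ Finset.range (K + 1), a i * ((min 2 (k / 2 ^ i) : ℕ) : ℝ)
      = 2 * ∑ i ∈ Finset.range (Nat.log 2 k), a i + a (Nat.log 2 k) := by
  set l := Nat.log 2 k with hl
  have hk0 : k ≠ 0 := by omega
  have h1 : 2 ^ l ≤ k := Nat.pow_log_le_self 2 hk0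
  have h2 : k < 2 ^ (l + 1) := Nat.lt_pow_succ_log_self (by norm_num) k
  have hlK : l ≤ K := Nat.lt_succ_iff.mp (Nat.log_lt_of_lt_pow hk0 hk')
  rw [Finset.range_eq_Ico, ← Finset.sum_Ico_consecutive _ (Nat.zero_le (l + 1))
    (by omega : l + 1 ≤ K + 1), Finset.sum_Ico_succ_top (Nat.zero_le l)]
  have htail : ∑ i ∈ Finset.Ico (l + 1) (K + 1), a i * ((min 2 (k / 2 ^ i) : ℕ) : ℝ) = 0 := by
    refine Finset.sum_eq_zero fun i hi => ?_
    rw [Finset.mem_Ico] at hi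
    have h6 : 2 ^ (l + 1) ≤ 2 ^ i := Nat.pow_le_pow_right (by norm_num) hi.1
    have h7 : k / 2 ^ i = 0 := Nat.div_eq_of_lt (by omega)
    simp [h7]
  have hmid : ((min 2 (k / 2 ^ l) : ℕ) : ℝ) = 1 := by
    have h3 : 1 ≤ k / 2 ^ l := (Nat.le_div_iff_mul_le (by positivity)).2 (by simpa using h1)
    have h4 : k / 2 ^ l < 2 := (Nat.div_lt_iff_lt_mul (by positivity)).2 (by rw [pow_succ] at h2; omega)
    have h5 : k / 2 ^ l = 1 := by omega
    simp [h5]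
  have hhead : ∑ i ∈ Finset.Ico 0 l, a i * ((min 2 (k / 2 ^ i) : ℕ) : ℝ)
      = ∑ i ∈ Finset.Ico 0 l, a i * 2 := by
    refine Finset.sum_congr rfl fun i hi => ?_
    rw [Finset.mem_Ico] at hi
    have h6 : 2 ^ (i + 1) ≤ 2 ^ l := Nat.pow_le_pow_right (by norm_num) hi.2
    have h5 : 2 ≤ k / 2 ^ i :=
      (Nat.le_div_iff_mul_le (by positivity)).2 (by rw [pow_succ] at h6; omega)
    rw [min_eq_left h5]
    push_cast
    ring
  rw [htail, hmid, hhead, add_zero, mul_one, ← Finset.sum_mul, Finset.range_eq_Ico]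
  ring

/-- **Crux `DyadicPrimalResidual`** (item stmt-RiemannHypothesis-22782) of route `NbSectionTwoDyadic`:
the explicit dyadic vector has block residual `4(−2)^⌊log₂ k⌋/D` for `1 ≤ k < 2^(K+1)` and tail
`(−1)^(K+1) 2^(K+1)/D`. RH-free; no summit is proved by this. -/
theorem DyadicPrimalResidual_proof :
    Summit.RiemannHypothesis.RiemannHypothesis.Theses.NbSectionTwoDyadic.DyadicPrimalResidual := by
  unfold Summit.RiemannHypothesis.RiemannHypothesis.Theses.NbSectionTwoDyadic.DyadicPrimalResidual
  intro K
  refine ⟨fun k hk hk' => ?_, ?_⟩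
  · rw [sum_mul_min_two_div_pow K k hk hk'
      (fun i => (-1 : ℝ) ^ i * (6 * (3 * 2 ^ K - 2 ^ (i + 1))) / (18 * 2 ^ K - 8))]
    exact primal_closed_form K (Nat.log 2 k)
  · have h := primal_closed_form K (K + 1)
    simp only [neg_two_pow_eq] at h
    linear_combination h

end Summit.RiemannHypothesis.RiemannHypothesis.Theorems.NbSectionTwo

end
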